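import Summits.HodgeConjecture.HodgeConjecture.Theorems.HodgeLocusCensusSigmaFamilySmoothSharp

/-!
# Hodge-locus census — THEOREM SM-∞'s smoothness clause UNIFORM IN THE DEGREE: the Σ-family member
# `F_N = N·F₀ + F₁` is smooth for EVERY `d ≥ 4`, every `k′ ≥ 3` and every real `N ≥ 2`

certified instances and evidence bearing on the general Hodge conjecture; no claim.

ENGINE B gen 41 (item B41-Σ∀; record `ENGINEB-g41.md`, derivation `gen41/DERIVATION-UNIFORM.md`).  Setting of THEOREM SM-∞
(`HodgeLocusCensusSigmaFamilySmoothAll`): coordinates `a b : ℂ`, `x y : ℕ → ℂ` (indices `< k`, `k = k′ ≥ 3`), `d = e + 3 ≥ 4`,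
`F₀ = Σ_{j<k} (y_j x_j^{e+2} + y_j^{e+3}) + a^{e+2} b + a b^{e+2}`, `F₁ = −Σ_{j≤k−3} y_j x_{j+1}^{e+1} x_{j+2} − y_{k−2} x_0 x_{k−1}^{e+1}
+ a b x_0^e x_1`, `F_N = N·F₀ + F₁`.  SM-∞ (`SigmaFamilySmoothAll.sigma_member_nonsingular`) proves `V(F_N) ⊂ ℙ^{2k+1}` smooth for
real `N ≥ 2e + 5 = 2d − 1`; the anchor `SigmaFamilySmoothSharp.sigma_member_nonsingular_two_le` lowers this to `N ≥ 2` at `e = 1`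
(`d = 4`) only.  THIS SHEET proves the clause for EVERY `e ≥ 1` and every real `N ≥ 2` (`sigma_member_nonsingular_two_le_all`:
SM-∞'s hypothesis list VERBATIM with `hN : 2 ≤ N`) through the explicit sufficient condition `e + 3 < N^{e+1}(N − 1)`
(`sigma_member_nonsingular_of_lt`, every `e ≥ 1`, `N > 0`), whose threshold is exactly `2` at `e = 1` and decreases to `1` as
`d → ∞` (`≈ 1.82, 1.71, 1.62` at `d = 5, 6, 7`); `N ≥ 2` meets it for `e ≥ 2` (`2^{e+1} > e + 3`), and `e = 1, N ≥ 2` is the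
imported anchor.  So the (Σ)-row member of THEOREM SM-∞ is smooth for every integer `N ≥ 2` in every cell `(2k′, d, k′ − 1)`,
`k′ ≥ 3`, `d ≥ 4` (was `N ≥ 2d − 1`).  No census number changes; nothing about Hodge loci beyond SM-∞'s record.

METHOD (constants ours).  `m > 0` = sup norm of ALL `2k + 2` coordinates (as in SM-∞), attained somewhere; coupling bounds
`‖∂F₁/∂y_j‖ ≤ m^{e+2}` (ONE monomial, coefficient `1` — the sharpening) and `‖∂F₁/∂x_i‖ ≤ (e+2)m^{e+2}` (SM-∞'s).  (Y) `‖y_j‖ = m`: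
`∂F_N/∂y_j = 0` forces `N(e+2)m^{e+2} ≤ m^{e+2}`.  (AB) `‖a‖ = m` (or `‖b‖ = m`, symmetric): BRACKET ALGEBRA
`∂F_N/∂b = a·[N(a^{e+1} + (e+2)b^{e+1}) + x_0^e x_1]`, `∂F_N/∂a = b·[N((e+2)a^{e+1} + b^{e+1}) + x_0^e x_1]`; `a ≠ 0` kills the first
bracket; `b = 0` then gives `N m^{e+1} ≤ m^{e+1}`, and `b ≠ 0` kills the second bracket too, so `a^{e+1} = b^{e+1}` and
`N(e+3)m^{e+1} = ‖x_0^e x_1‖ ≤ m^{e+1}`.  (X) `‖x_i‖ = m`: if `N‖y_i‖ > m`, `∂F_N/∂x_i = 0` gives `N(e+2)m^{e+1}‖y_i‖ ≤ (e+2)m^{e+2}`;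
if `N‖y_i‖ ≤ m`, `∂F_N/∂y_i = 0` gives `N(m^{e+2} − (e+3)‖y_i‖^{e+2}) ≤ m^{e+2}` with `N^{e+2}‖y_i‖^{e+2} ≤ m^{e+2}`, i.e.
`N^{e+1}(N − 1) ≤ e + 3`.  No weights, no certificates.  CONTENTS: `ab_block_core`, `ab_block`, `y_block`, `x_block`,
`sigma_member_nonsingular_of_lt`, `two_pow_gt`, `sigma_member_nonsingular_two_le_of_two_le` (`e ≥ 2`, `N ≥ 2`),
`sigma_member_nonsingular_two_le_all` (`e ≥ 1`, `N ≥ 2`), one consistency `example` (SM-∞'s own term proves this sheet's hypothesis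
list on SM-∞'s range).  Def-free; no `sorry`; default heartbeats; no `decide`; imports only `HodgeLocusCensusSigmaFamilySmoothSharp`.
-/

set_option linter.dupNamespace false

namespace Summit.HodgeConjecture.HodgeConjecture.HodgeLocus.Census.SigmaFamilySmoothUniform

open Summit.HodgeConjecture.HodgeConjecture.HodgeLocus.Census.SigmaFamilySmoothSharp (norm_sub_norm_le_norm_add)

/-- BRACKET ALGEBRA of the `(a, b)` block, any `e`, at a point where `‖a‖` is the sup norm `m > 0` of `a, b, x₀, x₁`:
`∂F_N/∂a = ∂F_N/∂b = 0` is impossible for real `N > 1`. -/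
theorem ab_block_core (e : ℕ) (N : ℝ) (hN : 1 < N) (a b x0 x1 : ℂ) (m : ℝ) (hm : 0 < m)
    (hx0 : ‖x0‖ ≤ m) (hx1 : ‖x1‖ ≤ m) (ha : ‖a‖ = m)
    (Ha : (N : ℂ) * (b * (((e : ℂ) + 2) * a ^ (e + 1) + b ^ (e + 1))) + b * x0 ^ e * x1 = 0)
    (Hb : (N : ℂ) * (a * (a ^ (e + 1) + ((e : ℂ) + 2) * b ^ (e + 1))) + a * x0 ^ e * x1 = 0) : False := by
  have hNC : ‖(N : ℂ)‖ = N := by rw [Complex.norm_real, Real.norm_of_nonneg (by linarith)]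
  have he3 : ‖((e : ℂ) + 3)‖ = (e : ℝ) + 3 := by
    rw [show ((e : ℂ) + 3) = (((e + 3 : ℕ)) : ℂ) by push_cast; ring, Complex.norm_natCast]; push_cast; ring
  have hmp : 0 < m ^ (e + 1) := pow_pos hm _
  have hxx : ‖x0 ^ e * x1‖ ≤ m ^ (e + 1) := by
    calc ‖x0 ^ e * x1‖ = ‖x0‖ ^ e * ‖x1‖ := by rw [norm_mul, norm_pow]
      _ ≤ m ^ e * m := by gcongr
      _ = m ^ (e + 1) := by ring
  have ha0 : a ≠ 0 := by
    intro h; rw [h, norm_zero] at ha; linarith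
  have Hb' : a * ((N : ℂ) * (a ^ (e + 1) + ((e : ℂ) + 2) * b ^ (e + 1)) + x0 ^ e * x1) = 0 := by
    linear_combination Hb
  have Bb : (N : ℂ) * (a ^ (e + 1) + ((e : ℂ) + 2) * b ^ (e + 1)) + x0 ^ e * x1 = 0 :=
    (mul_eq_zero.mp Hb').resolve_left ha0
  by_cases hb0 : b = 0
  · -- b = 0: N a^{e+1} = -x₀^e x₁, so N m^{e+1} ≤ m^{e+1}
    have hz : (0 : ℂ) ^ (e + 1) = 0 := zero_pow (Nat.succ_ne_zero e)
    rw [hb0, hz, mul_zero, add_zero] at Bb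
    have h1 : (N : ℂ) * a ^ (e + 1) = -(x0 ^ e * x1) := eq_neg_of_add_eq_zero_left Bb
    have h2 : N * m ^ (e + 1) ≤ m ^ (e + 1) := by
      calc N * m ^ (e + 1) = ‖(N : ℂ) * a ^ (e + 1)‖ := by rw [norm_mul, norm_pow, hNC, ha]
        _ = ‖x0 ^ e * x1‖ := by rw [h1, norm_neg]
        _ ≤ m ^ (e + 1) := hxx
    nlinarith
  · -- b ≠ 0: both brackets vanish, a^{e+1} = b^{e+1}, N(e+3)a^{e+1} = -x₀^e x₁
    have Ha' : b * ((N : ℂ) * (((e : ℂ) + 2) * a ^ (e + 1) + b ^ (e + 1)) + x0 ^ e * x1) = 0 := by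
      linear_combination Ha
    have Ba : (N : ℂ) * (((e : ℂ) + 2) * a ^ (e + 1) + b ^ (e + 1)) + x0 ^ e * x1 = 0 :=
      (mul_eq_zero.mp Ha').resolve_left hb0
    have hdiff : ((N : ℂ) * ((e : ℂ) + 1)) * (a ^ (e + 1) - b ^ (e + 1)) = 0 := by
      linear_combination Ba - Bb
    have hN0 : (N : ℂ) ≠ 0 := by exact_mod_cast (lt_trans zero_lt_one hN).ne'
    have he1 : ((e : ℂ) + 1) ≠ 0 := by
      rw [show ((e : ℂ) + 1) = (((e + 1 : ℕ)) : ℂ) by push_cast; ring]; exact_mod_cast Nat.succ_ne_zero e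
    have hab : a ^ (e + 1) - b ^ (e + 1) = 0 :=
      (mul_eq_zero.mp hdiff).resolve_left (mul_ne_zero hN0 he1)
    have h1 : (N : ℂ) * ((e : ℂ) + 3) * a ^ (e + 1) = -(x0 ^ e * x1) := by
      apply eq_neg_of_add_eq_zero_left
      linear_combination Bb + (N : ℂ) * ((e : ℂ) + 2) * hab
    have h2 : N * ((e : ℝ) + 3) * m ^ (e + 1) ≤ m ^ (e + 1) := by
      calc N * ((e : ℝ) + 3) * m ^ (e + 1) = ‖(N : ℂ) * ((e : ℂ) + 3) * a ^ (e + 1)‖ := by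
            rw [norm_mul, norm_mul, norm_pow, hNC, he3, ha]
        _ = ‖x0 ^ e * x1‖ := by rw [h1, norm_neg]
        _ ≤ m ^ (e + 1) := hxx
    have he0 : (0 : ℝ) ≤ (e : ℝ) := Nat.cast_nonneg e
    have hNe : 0 ≤ N * (e : ℝ) := mul_nonneg (by linarith) he0
    have h3 : 1 * m ^ (e + 1) < (N * ((e : ℝ) + 3)) * m ^ (e + 1) := mul_lt_mul_of_pos_right (by linarith) hmp
    linarith

/-- The `(a, b)` block at a point where `‖a‖ = m` or `‖b‖ = m` (`m > 0` the sup norm): `∂F_N/∂a = ∂F_N/∂b = 0` is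
impossible for real `N > 1` (the case `‖b‖ = m` is the core case with `a ↔ b` swapped — the block is symmetric). -/
theorem ab_block (e : ℕ) (N : ℝ) (hN : 1 < N) (a b x0 x1 : ℂ) (m : ℝ) (hm : 0 < m)
    (hx0 : ‖x0‖ ≤ m) (hx1 : ‖x1‖ ≤ m) (hab : ‖a‖ = m ∨ ‖b‖ = m)
    (Ha : (N : ℂ) * (b * (((e : ℂ) + 2) * a ^ (e + 1) + b ^ (e + 1))) + b * x0 ^ e * x1 = 0)
    (Hb : (N : ℂ) * (a * (a ^ (e + 1) + ((e : ℂ) + 2) * b ^ (e + 1))) + a * x0 ^ e * x1 = 0) : False := by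
  rcases hab with ha | hb
  · exact ab_block_core e N hN a b x0 x1 m hm hx0 hx1 ha Ha Hb
  · exact ab_block_core e N hN b a x0 x1 m hm hx0 hx1 hb (by linear_combination Hb) (by linear_combination Ha)

/-- Block `(x_j, y_j)` at a point where `‖y_j‖ = m > 0` is the sup norm: `∂F_N/∂y_j = N(x_j^{e+2} + (e+3)y_j^{e+2}) + t = 0`
with a coupling part `‖t‖ ≤ m^{e+2}` is impossible for real `N > 1`. -/
theorem y_block (e : ℕ) (N : ℝ) (hN : 1 < N) (xj yj t : ℂ) (m : ℝ) (hm : 0 < m)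
    (hyj : ‖yj‖ = m) (hxj : ‖xj‖ ≤ m) (ht : ‖t‖ ≤ m ^ (e + 2))
    (Hy : (N : ℂ) * (xj ^ (e + 2) + ((e : ℂ) + 3) * yj ^ (e + 2)) + t = 0) : False := by
  have hNC : ‖(N : ℂ)‖ = N := by rw [Complex.norm_real, Real.norm_of_nonneg (by linarith)]
  have he3 : ‖((e : ℂ) + 3)‖ = (e : ℝ) + 3 := by
    rw [show ((e : ℂ) + 3) = (((e + 3 : ℕ)) : ℂ) by push_cast; ring, Complex.norm_natCast]; push_cast; ring
  have hmp : 0 < m ^ (e + 2) := pow_pos hm _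
  have he0 : (0 : ℝ) ≤ (e : ℝ) := Nat.cast_nonneg e
  have h1 : (N : ℂ) * (xj ^ (e + 2) + ((e : ℂ) + 3) * yj ^ (e + 2)) = -t := eq_neg_of_add_eq_zero_left Hy
  have hx : ‖xj ^ (e + 2)‖ ≤ m ^ (e + 2) := by rw [norm_pow]; gcongr
  have hy : ‖((e : ℂ) + 3) * yj ^ (e + 2)‖ = ((e : ℝ) + 3) * m ^ (e + 2) := by rw [norm_mul, norm_pow, he3, hyj]
  have hrev : ‖((e : ℂ) + 3) * yj ^ (e + 2)‖ - ‖xj ^ (e + 2)‖ ≤ ‖xj ^ (e + 2) + ((e : ℂ) + 3) * yj ^ (e + 2)‖ := by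
    rw [add_comm (xj ^ (e + 2))]; exact norm_sub_norm_le_norm_add _ _
  have h2 : N * (((e : ℝ) + 2) * m ^ (e + 2)) ≤ m ^ (e + 2) := by
    calc N * (((e : ℝ) + 2) * m ^ (e + 2)) ≤ N * ‖xj ^ (e + 2) + ((e : ℂ) + 3) * yj ^ (e + 2)‖ := by
            apply mul_le_mul_of_nonneg_left _ (by linarith); linarith
      _ = ‖(N : ℂ) * (xj ^ (e + 2) + ((e : ℂ) + 3) * yj ^ (e + 2))‖ := by rw [norm_mul, hNC]
      _ = ‖t‖ := by rw [h1, norm_neg]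
      _ ≤ m ^ (e + 2) := ht
  have hNe : 0 ≤ N * (e : ℝ) := mul_nonneg (by linarith) he0
  have h3 : 1 * m ^ (e + 2) < (N * ((e : ℝ) + 2)) * m ^ (e + 2) := mul_lt_mul_of_pos_right (by linarith) hmp
  linarith

/-- Block `(x_i, y_i)` at a point where `‖x_i‖ = m > 0` is the sup norm: `∂F_N/∂x_i = N(e+2)x_i^{e+1}y_i + c = 0` and
`∂F_N/∂y_i = N(x_i^{e+2} + (e+3)y_i^{e+2}) + t = 0` with coupling parts `‖c‖ ≤ (e+2)m^{e+2}`, `‖t‖ ≤ m^{e+2}` are impossible for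
real `N > 0` with `e + 3 < N^{e+1}(N − 1)`: if `N‖y_i‖ > m` the first equation gives `N‖y_i‖ ≤ m`; if `N‖y_i‖ ≤ m` the second
gives `N^{e+1}(N − 1) ≤ e + 3`. -/
theorem x_block (e : ℕ) (N : ℝ) (hN0 : 0 < N) (hN : (e : ℝ) + 3 < N ^ (e + 1) * (N - 1)) (xi yi c t : ℂ) (m : ℝ)
    (hm : 0 < m) (hxi : ‖xi‖ = m) (hc : ‖c‖ ≤ ((e : ℝ) + 2) * m ^ (e + 2)) (ht : ‖t‖ ≤ m ^ (e + 2))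
    (Hx : (N : ℂ) * (((e : ℂ) + 2) * xi ^ (e + 1) * yi) + c = 0)
    (Hy : (N : ℂ) * (xi ^ (e + 2) + ((e : ℂ) + 3) * yi ^ (e + 2)) + t = 0) : False := by
  have hNC : ‖(N : ℂ)‖ = N := by rw [Complex.norm_real, Real.norm_of_nonneg hN0.le]
  have he2 : ‖((e : ℂ) + 2)‖ = (e : ℝ) + 2 := by
    rw [show ((e : ℂ) + 2) = (((e + 2 : ℕ)) : ℂ) by push_cast; ring, Complex.norm_natCast]; push_cast; ring
  have he3 : ‖((e : ℂ) + 3)‖ = (e : ℝ) + 3 := by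
    rw [show ((e : ℂ) + 3) = (((e + 3 : ℕ)) : ℂ) by push_cast; ring, Complex.norm_natCast]; push_cast; ring
  have he0 : (0 : ℝ) ≤ (e : ℝ) := Nat.cast_nonneg e
  have hmp : 0 < m ^ (e + 1) := pow_pos hm _
  by_cases h1 : m < N * ‖yi‖
  · -- N‖y_i‖ > m: the x_i-partial
    have k1 : (N : ℂ) * (((e : ℂ) + 2) * xi ^ (e + 1) * yi) = -c := eq_neg_of_add_eq_zero_left Hx
    have k2 : N * (((e : ℝ) + 2) * m ^ (e + 1) * ‖yi‖) ≤ ((e : ℝ) + 2) * m ^ (e + 2) := by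
      calc N * (((e : ℝ) + 2) * m ^ (e + 1) * ‖yi‖) = ‖(N : ℂ) * (((e : ℂ) + 2) * xi ^ (e + 1) * yi)‖ := by
            rw [norm_mul, norm_mul, norm_mul, norm_pow, hNC, he2, hxi]
        _ = ‖c‖ := by rw [k1, norm_neg]
        _ ≤ ((e : ℝ) + 2) * m ^ (e + 2) := hc
    have k3 : (N * ‖yi‖) * (((e : ℝ) + 2) * m ^ (e + 1)) ≤ m * (((e : ℝ) + 2) * m ^ (e + 1)) := by
      have : ((e : ℝ) + 2) * m ^ (e + 2) = m * (((e : ℝ) + 2) * m ^ (e + 1)) := by ring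
      rw [← this]; linarith
    have k4 : N * ‖yi‖ ≤ m := le_of_mul_le_mul_right k3 (by positivity)
    linarith
  · -- N‖y_i‖ ≤ m: the y_i-partial
    push Not at h1
    have hy0 : 0 ≤ N * ‖yi‖ := by positivity
    have k0 : (N * ‖yi‖) ^ (e + 2) ≤ m ^ (e + 2) := pow_le_pow_left₀ hy0 h1 _
    have k1 : (N : ℂ) * (xi ^ (e + 2) + ((e : ℂ) + 3) * yi ^ (e + 2)) = -t := eq_neg_of_add_eq_zero_left Hy
    have hx : ‖xi ^ (e + 2)‖ = m ^ (e + 2) := by rw [norm_pow, hxi]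
    have hy : ‖((e : ℂ) + 3) * yi ^ (e + 2)‖ = ((e : ℝ) + 3) * ‖yi‖ ^ (e + 2) := by rw [norm_mul, norm_pow, he3]
    have hrev : ‖xi ^ (e + 2)‖ - ‖((e : ℂ) + 3) * yi ^ (e + 2)‖ ≤ ‖xi ^ (e + 2) + ((e : ℂ) + 3) * yi ^ (e + 2)‖ :=
      norm_sub_norm_le_norm_add _ _
    have k2 : N * (m ^ (e + 2) - ((e : ℝ) + 3) * ‖yi‖ ^ (e + 2)) ≤ m ^ (e + 2) := by
      calc N * (m ^ (e + 2) - ((e : ℝ) + 3) * ‖yi‖ ^ (e + 2)) ≤ N * ‖xi ^ (e + 2) + ((e : ℂ) + 3) * yi ^ (e + 2)‖ := by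
            apply mul_le_mul_of_nonneg_left _ hN0.le; linarith
        _ = ‖(N : ℂ) * (xi ^ (e + 2) + ((e : ℂ) + 3) * yi ^ (e + 2))‖ := by rw [norm_mul, hNC]
        _ = ‖t‖ := by rw [k1, norm_neg]
        _ ≤ m ^ (e + 2) := ht
    -- bookkeeping: P = m^{e+2} > 0, Q = N^{e+1} > 0, Y = ‖y_i‖^{e+2}; Q·k2 + (e+3)·k0 + P·hN is linear in the monomials
    have hP : 0 < m ^ (e + 2) := pow_pos hm _
    have hQ : 0 < N ^ (e + 1) := pow_pos hN0 _
    have k0' : N * N ^ (e + 1) * ‖yi‖ ^ (e + 2) ≤ m ^ (e + 2) := by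
      have : (N * ‖yi‖) ^ (e + 2) = N * N ^ (e + 1) * ‖yi‖ ^ (e + 2) := by rw [mul_pow]; ring
      linarith [this]
    nlinarith [mul_le_mul_of_nonneg_right k2 hQ.le, mul_le_mul_of_nonneg_left k0' (show (0 : ℝ) ≤ (e : ℝ) + 3 by linarith),
      mul_lt_mul_of_pos_right hN hP]

/-- THE UNIFORM PERTURBATION LEMMA with its explicit condition: for every `k ≥ 3`, every `e ≥ 1` and every real `N > 0` with
`e + 3 < N^{e+1}(N − 1)`, the `2k + 2` partial derivatives of `F_N = N·F₀ + F₁` (THEOREM SM-∞'s hypothesis list VERBATIM) have no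
common zero `≠ 0`: `V(F_N) ⊂ ℙ^{2k+1}` is smooth.  (At `e = 1` the condition reads `N > 2`; its threshold decreases to `1` as `e → ∞`.) -/
theorem sigma_member_nonsingular_of_lt (k : ℕ) (hk : 3 ≤ k) (e : ℕ) (he : 1 ≤ e) (N : ℝ) (hN0 : 0 < N)
    (hN : (e : ℝ) + 3 < N ^ (e + 1) * (N - 1))
    (a b : ℂ) (x y : ℕ → ℂ)
    (hne : ¬ (a = 0 ∧ b = 0 ∧ ∀ i < k, x i = 0 ∧ y i = 0)) :
    ¬ ( (N : ℂ) * (b * (((e : ℂ) + 2) * a ^ (e + 1) + b ^ (e + 1))) + b * x 0 ^ e * x 1 = 0 ∧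
        (N : ℂ) * (a * (a ^ (e + 1) + ((e : ℂ) + 2) * b ^ (e + 1))) + a * x 0 ^ e * x 1 = 0 ∧
        (∀ i < k, (N : ℂ) * (((e : ℂ) + 2) * x i ^ (e + 1) * y i) +
            (if i = 0 then -(y (k - 2) * x (k - 1) ^ (e + 1)) + (e : ℂ) * a * b * x 0 ^ (e - 1) * x 1
             else if i = 1 then -(((e : ℂ) + 1) * y 0 * x 1 ^ e * x 2) + a * b * x 0 ^ e
             else if i + 1 < k then -(y (i - 2) * x (i - 1) ^ (e + 1)) - ((e : ℂ) + 1) * y (i - 1) * x i ^ e * x (i + 1)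
             else -(y (k - 3) * x (k - 2) ^ (e + 1)) - ((e : ℂ) + 1) * y (k - 2) * x 0 * x (k - 1) ^ e) = 0) ∧
        (∀ j < k, (N : ℂ) * (x j ^ (e + 2) + ((e : ℂ) + 3) * y j ^ (e + 2)) +
            (if j + 3 ≤ k then -(x (j + 1) ^ (e + 1) * x (j + 2))
             else if j + 2 = k then -(x 0 * x (k - 1) ^ (e + 1))
             else 0) = 0) ) := by
  rintro ⟨Ha, Hb, Hx, Hy⟩
  -- N > 1 from the condition
  have hN1 : 1 < N := by
    by_contra h
    have : 0 ≤ N ^ (e + 1) * (1 - N) := mul_nonneg (pow_nonneg hN0.le _) (by push Not at h; linarith)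
    nlinarith [(Nat.cast_nonneg e : (0 : ℝ) ≤ e)]
  -- the sup norm m over the 2k+2 coordinates and an index attaining it (as in SM-∞)
  let f : ℕ → ℝ := fun n => if n = 0 then ‖a‖ else if n = 1 then ‖b‖ else if n < k + 2 then ‖x (n - 2)‖ else ‖y (n - 2 - k)‖
  obtain ⟨n₀, hn₀, hmax⟩ := Finset.exists_max_image (Finset.range (2 * k + 2)) f ⟨0, by simp⟩
  have hn₀' : n₀ < 2 * k + 2 := Finset.mem_range.mp hn₀
  have key : ∀ n, n < 2 * k + 2 → f n ≤ f n₀ := fun n hn => hmax n (Finset.mem_range.mpr hn)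
  generalize hm_def : f n₀ = m at key
  have hA : ‖a‖ ≤ m := by have h := key 0 (by omega); simpa [f] using h
  have hB : ‖b‖ ≤ m := by have h := key 1 (by omega); simpa [f] using h
  have hX : ∀ i < k, ‖x i‖ ≤ m := by
    intro i hi
    have h := key (i + 2) (by omega)
    simp only [f, show ¬ (i + 2 = 0) from by omega, show ¬ (i + 2 = 1) from by omega, show i + 2 < k + 2 from by omega,
      if_false, if_true, Nat.add_sub_cancel] at h
    exact h
  have hY : ∀ i < k, ‖y i‖ ≤ m := by
    intro i hi
    have h := key (i + 2 + k) (by omega)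
    simp only [f, show ¬ (i + 2 + k = 0) from by omega, show ¬ (i + 2 + k = 1) from by omega,
      show ¬ (i + 2 + k < k + 2) from by omega, if_false, show i + 2 + k - 2 - k = i from by omega] at h
    exact h
  have hm : 0 < m := by
    by_contra hle
    have hle' : m ≤ 0 := not_lt.mp hle
    exact hne ⟨norm_le_zero_iff.mp (hA.trans hle'), norm_le_zero_iff.mp (hB.trans hle'),
      fun i hi => ⟨norm_le_zero_iff.mp ((hX i hi).trans hle'), norm_le_zero_iff.mp ((hY i hi).trans hle')⟩⟩
  -- numeric facts
  have hpow3 : m ^ (e + 2) = m * m * m ^ (e - 1) * m := by rw [show e + 2 = (e - 1) + 3 by omega]; ring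
  have hne1 : ‖((e : ℂ) + 1)‖ = (e : ℝ) + 1 := by
    rw [show ((e : ℂ) + 1) = (((e + 1 : ℕ)) : ℂ) by push_cast; ring, Complex.norm_natCast, Nat.cast_add, Nat.cast_one]
  obtain ⟨hk0, hk1, hk2⟩ : 0 < k ∧ 1 < k ∧ 2 < k := ⟨by omega, by omega, by omega⟩
  -- coupling bounds ‖∂F₁/∂x_i‖ ≤ (e+2) m^{e+2}, by position of i (SM-∞'s bound); two monomial shapes recur
  have tA : ∀ p q, p < k → q < k → ‖-(y p * x q ^ (e + 1))‖ ≤ m ^ (e + 2) := by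
    intro p q hp hq
    calc ‖-(y p * x q ^ (e + 1))‖ = ‖y p‖ * ‖x q‖ ^ (e + 1) := by rw [norm_neg, norm_mul, norm_pow]
      _ ≤ m * m ^ (e + 1) := by gcongr; exacts [hY p hp, hX q hq]
      _ = m ^ (e + 2) := by ring
  have tB : ∀ p q r, p < k → q < k → r < k →
      ‖((e : ℂ) + 1) * y p * x q ^ e * x r‖ ≤ ((e : ℝ) + 1) * m ^ (e + 2) := by
    intro p q r hp hq hr
    calc ‖((e : ℂ) + 1) * y p * x q ^ e * x r‖ = ((e : ℝ) + 1) * ‖y p‖ * ‖x q‖ ^ e * ‖x r‖ := by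
          rw [norm_mul, norm_mul, norm_mul, norm_pow, hne1]
      _ ≤ ((e : ℝ) + 1) * m * m ^ e * m := by gcongr; exacts [hY p hp, hX q hq, hX r hr]
      _ = ((e : ℝ) + 1) * m ^ (e + 2) := by ring
  have cx : ∀ i < k, ‖(if i = 0 then -(y (k - 2) * x (k - 1) ^ (e + 1)) + (e : ℂ) * a * b * x 0 ^ (e - 1) * x 1
             else if i = 1 then -(((e : ℂ) + 1) * y 0 * x 1 ^ e * x 2) + a * b * x 0 ^ e
             else if i + 1 < k then -(y (i - 2) * x (i - 1) ^ (e + 1)) - ((e : ℂ) + 1) * y (i - 1) * x i ^ e * x (i + 1)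
             else -(y (k - 3) * x (k - 2) ^ (e + 1)) - ((e : ℂ) + 1) * y (k - 2) * x 0 * x (k - 1) ^ e)‖
             ≤ ((e : ℝ) + 2) * m ^ (e + 2) := by
    intro i hi
    split_ifs with h0 h1 h2
    · have t2 : ‖(e : ℂ) * a * b * x 0 ^ (e - 1) * x 1‖ ≤ (e : ℝ) * m ^ (e + 2) := by
        calc ‖(e : ℂ) * a * b * x 0 ^ (e - 1) * x 1‖ = (e : ℝ) * ‖a‖ * ‖b‖ * ‖x 0‖ ^ (e - 1) * ‖x 1‖ := by
              rw [norm_mul, norm_mul, norm_mul, norm_mul, norm_pow, Complex.norm_natCast]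
          _ ≤ (e : ℝ) * m * m * m ^ (e - 1) * m := by gcongr; exacts [hX 0 hk0, hX 1 hk1]
          _ = (e : ℝ) * m ^ (e + 2) := by rw [hpow3]; ring
      calc _ ≤ ‖-(y (k - 2) * x (k - 1) ^ (e + 1))‖ + ‖(e : ℂ) * a * b * x 0 ^ (e - 1) * x 1‖ := norm_add_le _ _
        _ ≤ m ^ (e + 2) + (e : ℝ) * m ^ (e + 2) := add_le_add (tA _ _ (by omega) (by omega)) t2
        _ ≤ ((e : ℝ) + 2) * m ^ (e + 2) := by nlinarith [pow_pos hm (e + 2)]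
    · have t2 : ‖a * b * x 0 ^ e‖ ≤ m ^ (e + 2) := by
        calc ‖a * b * x 0 ^ e‖ = ‖a‖ * ‖b‖ * ‖x 0‖ ^ e := by rw [norm_mul, norm_mul, norm_pow]
          _ ≤ m * m * m ^ e := by gcongr; exact hX 0 hk0
          _ = m ^ (e + 2) := by ring
      calc _ ≤ ‖-(((e : ℂ) + 1) * y 0 * x 1 ^ e * x 2)‖ + ‖a * b * x 0 ^ e‖ := norm_add_le _ _
        _ ≤ ((e : ℝ) + 1) * m ^ (e + 2) + m ^ (e + 2) := by
          rw [norm_neg]; exact add_le_add (tB 0 1 2 hk0 hk1 hk2) t2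
        _ = ((e : ℝ) + 2) * m ^ (e + 2) := by ring
    · calc _ ≤ ‖-(y (i - 2) * x (i - 1) ^ (e + 1))‖ + ‖((e : ℂ) + 1) * y (i - 1) * x i ^ e * x (i + 1)‖ := norm_sub_le _ _
        _ ≤ m ^ (e + 2) + ((e : ℝ) + 1) * m ^ (e + 2) :=
          add_le_add (tA _ _ (by omega) (by omega)) (tB _ _ _ (by omega) hi h2)
        _ = ((e : ℝ) + 2) * m ^ (e + 2) := by ring
    · have t2 : ‖((e : ℂ) + 1) * y (k - 2) * x 0 * x (k - 1) ^ e‖ ≤ ((e : ℝ) + 1) * m ^ (e + 2) := by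
        calc ‖((e : ℂ) + 1) * y (k - 2) * x 0 * x (k - 1) ^ e‖ = ((e : ℝ) + 1) * ‖y (k - 2)‖ * ‖x 0‖ * ‖x (k - 1)‖ ^ e := by
              rw [norm_mul, norm_mul, norm_mul, norm_pow, hne1]
          _ ≤ ((e : ℝ) + 1) * m * m * m ^ e := by gcongr; exacts [hY (k - 2) (by omega), hX 0 hk0, hX (k - 1) (by omega)]
          _ = ((e : ℝ) + 1) * m ^ (e + 2) := by ring
      calc _ ≤ ‖-(y (k - 3) * x (k - 2) ^ (e + 1))‖ + ‖((e : ℂ) + 1) * y (k - 2) * x 0 * x (k - 1) ^ e‖ := norm_sub_le _ _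
        _ ≤ m ^ (e + 2) + ((e : ℝ) + 1) * m ^ (e + 2) := add_le_add (tA _ _ (by omega) (by omega)) t2
        _ = ((e : ℝ) + 2) * m ^ (e + 2) := by ring
  -- coupling bounds ‖∂F₁/∂y_j‖ ≤ m^{e+2} (ONE monomial with coefficient 1 — the sharpening)
  have cy : ∀ j < k, ‖(if j + 3 ≤ k then -(x (j + 1) ^ (e + 1) * x (j + 2))
             else if j + 2 = k then -(x 0 * x (k - 1) ^ (e + 1)) else 0)‖ ≤ m ^ (e + 2) := by
    intro j hj
    split_ifs with h3 h2
    · calc ‖-(x (j + 1) ^ (e + 1) * x (j + 2))‖ = ‖x (j + 1)‖ ^ (e + 1) * ‖x (j + 2)‖ := by rw [norm_neg, norm_mul, norm_pow]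
        _ ≤ m ^ (e + 1) * m := by gcongr; exacts [hX (j + 1) (by omega), hX (j + 2) (by omega)]
        _ = m ^ (e + 2) := by ring
    · calc ‖-(x 0 * x (k - 1) ^ (e + 1))‖ = ‖x 0‖ * ‖x (k - 1)‖ ^ (e + 1) := by rw [norm_neg, norm_mul, norm_pow]
        _ ≤ m * m ^ (e + 1) := by gcongr; exacts [hX 0 hk0, hX (k - 1) (by omega)]
        _ = m ^ (e + 2) := by ring
    · rw [norm_zero]; positivity
  -- which coordinate attains the sup norm
  rcases Nat.lt_or_ge n₀ 2 with h01 | h2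
  · have hab : ‖a‖ = m ∨ ‖b‖ = m := by
      interval_cases n₀
      · left; simpa [f] using hm_def
      · right; simpa [f] using hm_def
    exact ab_block e N hN1 a b (x 0) (x 1) m hm (hX 0 hk0) (hX 1 hk1) hab Ha Hb
  · rcases Nat.lt_or_ge n₀ (k + 2) with hx' | hy'
    · -- x (n₀ - 2) attains
      have hi : n₀ - 2 < k := by omega
      have h1 : ‖x (n₀ - 2)‖ = m := by
        simp only [f, show ¬ (n₀ = 0) from by omega, show ¬ (n₀ = 1) from by omega, hx', if_false, if_true] at hm_def
        exact hm_def
      exact x_block e N hN0 hN (x (n₀ - 2)) (y (n₀ - 2)) _ _ m hm h1 (cx _ hi) (cy _ hi) (Hx _ hi) (Hy _ hi)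
    · -- y (n₀ - 2 - k) attains
      have hi : n₀ - 2 - k < k := by omega
      have h1 : ‖y (n₀ - 2 - k)‖ = m := by
        simp only [f, show ¬ (n₀ = 0) from by omega, show ¬ (n₀ = 1) from by omega, show ¬ (n₀ < k + 2) from by omega,
          if_false] at hm_def
        exact hm_def
      exact y_block e N hN1 (x (n₀ - 2 - k)) (y (n₀ - 2 - k)) _ m hm h1 (hX _ hi) (cy _ hi) (Hy _ hi)

/-- `e + 3 < 2^{e+1}` for `e ≥ 2` (so that `N ≥ 2` satisfies the explicit condition for every `e ≥ 2`). -/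
theorem two_pow_gt (e : ℕ) (he : 2 ≤ e) : e + 3 < 2 ^ (e + 1) := by
  obtain ⟨d, rfl⟩ : ∃ d, e = d + 2 := ⟨e - 2, by omega⟩
  have h : ∀ n : ℕ, n + 5 < 2 ^ (n + 3) := by
    intro n
    induction n with
    | zero => norm_num
    | succ n ih => rw [show n + 1 + 3 = (n + 3) + 1 by omega, pow_succ]; linarith [ih]
  have := h d
  rw [show d + 2 + 1 = d + 3 by omega]
  omega

/-- The smoothness clause for every `e ≥ 2` (`d ≥ 5`) and every real `N ≥ 2` (SM-∞'s hypothesis list verbatim, `hN : 2 ≤ N`):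
`N ≥ 2` gives `N^{e+1}(N − 1) ≥ 2^{e+1} > e + 3`. -/
theorem sigma_member_nonsingular_two_le_of_two_le (k : ℕ) (hk : 3 ≤ k) (e : ℕ) (he : 2 ≤ e) (N : ℝ) (hN : 2 ≤ N)
    (a b : ℂ) (x y : ℕ → ℂ)
    (hne : ¬ (a = 0 ∧ b = 0 ∧ ∀ i < k, x i = 0 ∧ y i = 0)) :
    ¬ ( (N : ℂ) * (b * (((e : ℂ) + 2) * a ^ (e + 1) + b ^ (e + 1))) + b * x 0 ^ e * x 1 = 0 ∧
        (N : ℂ) * (a * (a ^ (e + 1) + ((e : ℂ) + 2) * b ^ (e + 1))) + a * x 0 ^ e * x 1 = 0 ∧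
        (∀ i < k, (N : ℂ) * (((e : ℂ) + 2) * x i ^ (e + 1) * y i) +
            (if i = 0 then -(y (k - 2) * x (k - 1) ^ (e + 1)) + (e : ℂ) * a * b * x 0 ^ (e - 1) * x 1
             else if i = 1 then -(((e : ℂ) + 1) * y 0 * x 1 ^ e * x 2) + a * b * x 0 ^ e
             else if i + 1 < k then -(y (i - 2) * x (i - 1) ^ (e + 1)) - ((e : ℂ) + 1) * y (i - 1) * x i ^ e * x (i + 1)
             else -(y (k - 3) * x (k - 2) ^ (e + 1)) - ((e : ℂ) + 1) * y (k - 2) * x 0 * x (k - 1) ^ e) = 0) ∧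
        (∀ j < k, (N : ℂ) * (x j ^ (e + 2) + ((e : ℂ) + 3) * y j ^ (e + 2)) +
            (if j + 3 ≤ k then -(x (j + 1) ^ (e + 1) * x (j + 2))
             else if j + 2 = k then -(x 0 * x (k - 1) ^ (e + 1))
             else 0) = 0) ) := by
  have h2 : ((e : ℝ) + 3) < (2 : ℝ) ^ (e + 1) := by exact_mod_cast two_pow_gt e he
  have hQ : (2 : ℝ) ^ (e + 1) ≤ N ^ (e + 1) := pow_le_pow_left₀ (by norm_num) hN (e + 1)
  have hcond : (e : ℝ) + 3 < N ^ (e + 1) * (N - 1) := by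
    have : (2 : ℝ) ^ (e + 1) * 1 ≤ N ^ (e + 1) * (N - 1) :=
      mul_le_mul hQ (by linarith) (by norm_num) (pow_nonneg (by linarith) _)
    linarith
  exact sigma_member_nonsingular_of_lt k hk e (by omega) N (by linarith) hcond a b x y hne

/-- THEOREM SM-∞'s smoothness clause, UNIFORM IN THE DEGREE: for every `k ≥ 3`, every `e ≥ 1` (`d = e + 3 ≥ 4`), every real
`N ≥ 2` and `(a, b, x_0..x_{k−1}, y_0..y_{k−1}) ≠ 0`, the `2k + 2` partial derivatives of `F_N = N·F₀ + F₁` (SM-∞'s hypothesis list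
VERBATIM) do not vanish simultaneously: `V(F_N) ⊂ ℙ^{2k+1}` is smooth.  (`e = 1`: anchor `SigmaFamilySmoothSharp`; `e ≥ 2`: above.) -/
theorem sigma_member_nonsingular_two_le_all (k : ℕ) (hk : 3 ≤ k) (e : ℕ) (he : 1 ≤ e) (N : ℝ) (hN : 2 ≤ N)
    (a b : ℂ) (x y : ℕ → ℂ)
    (hne : ¬ (a = 0 ∧ b = 0 ∧ ∀ i < k, x i = 0 ∧ y i = 0)) :
    ¬ ( (N : ℂ) * (b * (((e : ℂ) + 2) * a ^ (e + 1) + b ^ (e + 1))) + b * x 0 ^ e * x 1 = 0 ∧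
        (N : ℂ) * (a * (a ^ (e + 1) + ((e : ℂ) + 2) * b ^ (e + 1))) + a * x 0 ^ e * x 1 = 0 ∧
        (∀ i < k, (N : ℂ) * (((e : ℂ) + 2) * x i ^ (e + 1) * y i) +
            (if i = 0 then -(y (k - 2) * x (k - 1) ^ (e + 1)) + (e : ℂ) * a * b * x 0 ^ (e - 1) * x 1
             else if i = 1 then -(((e : ℂ) + 1) * y 0 * x 1 ^ e * x 2) + a * b * x 0 ^ e
             else if i + 1 < k then -(y (i - 2) * x (i - 1) ^ (e + 1)) - ((e : ℂ) + 1) * y (i - 1) * x i ^ e * x (i + 1)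
             else -(y (k - 3) * x (k - 2) ^ (e + 1)) - ((e : ℂ) + 1) * y (k - 2) * x 0 * x (k - 1) ^ e) = 0) ∧
        (∀ j < k, (N : ℂ) * (x j ^ (e + 2) + ((e : ℂ) + 3) * y j ^ (e + 2)) +
            (if j + 3 ≤ k then -(x (j + 1) ^ (e + 1) * x (j + 2))
             else if j + 2 = k then -(x 0 * x (k - 1) ^ (e + 1))
             else 0) = 0) ) := by
  rcases he.eq_or_lt with h1 | h2
  · subst h1
    exact SigmaFamilySmoothSharp.sigma_member_nonsingular_two_le k hk N hN a b x y hne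
  · exact sigma_member_nonsingular_two_le_of_two_le k hk e h2 N hN a b x y hne

/- CONSISTENCY WITH SM-∞ (an `example`, kernel-checked at build time, no declaration): the hypothesis list of this sheet's theorems IS
the statement of THEOREM SM-∞ (`SigmaFamilySmoothAll.sigma_member_nonsingular`) — SM-∞'s own term proves it verbatim on SM-∞'s
range `N ≥ 2e + 5` (and conversely `sigma_member_nonsingular_two_le_all` gives SM-∞'s clause back there, since `2e + 5 ≥ 2`). -/
example (k : ℕ) (hk : 3 ≤ k) (e : ℕ) (he : 1 ≤ e) (N : ℝ) (hN : 2 * (e : ℝ) + 5 ≤ N) (a b : ℂ) (x y : ℕ → ℂ)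
    (hne : ¬ (a = 0 ∧ b = 0 ∧ ∀ i < k, x i = 0 ∧ y i = 0)) :
    ¬ ( (N : ℂ) * (b * (((e : ℂ) + 2) * a ^ (e + 1) + b ^ (e + 1))) + b * x 0 ^ e * x 1 = 0 ∧
        (N : ℂ) * (a * (a ^ (e + 1) + ((e : ℂ) + 2) * b ^ (e + 1))) + a * x 0 ^ e * x 1 = 0 ∧
        (∀ i < k, (N : ℂ) * (((e : ℂ) + 2) * x i ^ (e + 1) * y i) +
            (if i = 0 then -(y (k - 2) * x (k - 1) ^ (e + 1)) + (e : ℂ) * a * b * x 0 ^ (e - 1) * x 1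
             else if i = 1 then -(((e : ℂ) + 1) * y 0 * x 1 ^ e * x 2) + a * b * x 0 ^ e
             else if i + 1 < k then -(y (i - 2) * x (i - 1) ^ (e + 1)) - ((e : ℂ) + 1) * y (i - 1) * x i ^ e * x (i + 1)
             else -(y (k - 3) * x (k - 2) ^ (e + 1)) - ((e : ℂ) + 1) * y (k - 2) * x 0 * x (k - 1) ^ e) = 0) ∧
        (∀ j < k, (N : ℂ) * (x j ^ (e + 2) + ((e : ℂ) + 3) * y j ^ (e + 2)) +
            (if j + 3 ≤ k then -(x (j + 1) ^ (e + 1) * x (j + 2))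
             else if j + 2 = k then -(x 0 * x (k - 1) ^ (e + 1))
             else 0) = 0) ) :=
  SigmaFamilySmoothAll.sigma_member_nonsingular k hk e he N hN a b x y hne

end Summit.HodgeConjecture.HodgeConjecture.HodgeLocus.Census.SigmaFamilySmoothUniform
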